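import Mathlib
import Summits.ValiantsHypothesis.ValiantsHypothesis.Theorems.ProofCarryingSymmetryRestorationQPACUnfoldSize

/-!
# Route ProofCarryingSymmetry — crux `RestorationQP`, line `registered`, stub S3 (`stub_stabilityAtACBudget`), part 5:
the AC-canonical circuit of a class and its symmetry

Continuation of parts 1–4 (`ACStability.ACEq`, `ACClass`, `reach`, `topClass`).  For a class `t`
(later `t = topClass C`) and a chain length `L` we build a Dawar–Wilsenach labelled circuit
(`LabelledArithCircuit`, DW ToC 2025 Def. 2.2) `acCircuit t L hL` whose gates are

* `leaf q` — one input gate per reachable LEAF class `q` (label `var x` / `const c`),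
* `node q` — one gate per reachable INTERNAL class (label `+` / `×`),
* `pw p i`, `cp p i` (`p = (q, k)`, `k` a child of `q`, `i < L`) — the DOUBLING CHAIN of the child
  `k` under its parent `q`: `pw p 0` is a fan-in-one copy of the gate of `k`, `cp p i` a fan-in-one
  `+`-copy of `pw p i`, and `pw p (i+1)` has children `{pw p i, cp p i}`, so that `pw p i` computes
  `2^i · k̂` under a `+`-parent and `k̂^(2^i)` under a `×`-parent (part 6); the children of `node q`
  are the `pw (q,k) i` with `i` a binary digit of the MULTIPLICITY of `k` among the children of `q`
  — DW gates take a SET of children, so the multiset `q.kids` is realised through binary expansion,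
  at `2L` gates per (parent, child) pair instead of the multiplicity itself (which can be `2^|C|`).

The wiring is a relation `IsChild` decreasing a rank, labels are the classes' labels; distinct input
gates have distinct labels because leaf classes are determined by their label.  A group `Γ` acting
on the variables and FIXING `t` acts on the gates (`gperm`), by circuit automorphisms extending its
action on the variables (`isAutomorphismExtending_gperm`), so the circuit is `Γ`-symmetric
(DW Def. 3.7, `isSymmetric_acCircuit`).  Registered helper: `stabilityAtACBudget_aux_symmetric`.
Everything proved; no named facts.
-/

-- single-problem summit: `Summit.ValiantsHypothesis.ValiantsHypothesis.…` is the namespace by design (D-0017)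
set_option linter.dupNamespace false

noncomputable section

open scoped Classical

namespace Summit.ValiantsHypothesis.ValiantsHypothesis.Theorems

namespace ACStability

open Literature.Computability.AlgebraicComplexity ACClass

universe u v

variable {𝔽 : Type u} {X : Type v}

section Gates

variable (t : ACClass 𝔽 X) (L : ℕ)

/-- The gates of the AC-canonical circuit: input gates for reachable leaf classes, one gate per
reachable internal class, and the doubling chains `pw p i` / `cp p i` (`i < L`) of every
(parent, child) pair. [folklore] -/
inductive ACGate : Type (max u v)
  /-- input gate of the leaf class `q` -/
  | leaf (q : {q // q ∈ leafSet t}) : ACGate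
  /-- the gate of the internal class `q` -/
  | node (q : {q // q ∈ nodeSet t}) : ACGate
  /-- `i`-th element of the doubling chain of the pair `p` (computes `2^i ⋆ child`) -/
  | pw (p : {p // p ∈ pairSet t}) (i : Fin L) : ACGate
  /-- fan-in-one `+`-copy of `pw p i` -/
  | cp (p : {p // p ∈ pairSet t}) (i : Fin L) : ACGate

namespace ACGate

/-- The gates as a sum type. [folklore] -/
def equivSum : ACGate t L ≃ {q // q ∈ leafSet t} ⊕ {q // q ∈ nodeSet t} ⊕
    ({p // p ∈ pairSet t} × Fin L) ⊕ ({p // p ∈ pairSet t} × Fin L) where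
  toFun
    | leaf q => Sum.inl q
    | node q => Sum.inr (Sum.inl q)
    | pw p i => Sum.inr (Sum.inr (Sum.inl (p, i)))
    | cp p i => Sum.inr (Sum.inr (Sum.inr (p, i)))
  invFun
    | Sum.inl q => leaf q
    | Sum.inr (Sum.inl q) => node q
    | Sum.inr (Sum.inr (Sum.inl (p, i))) => pw p i
    | Sum.inr (Sum.inr (Sum.inr (p, i))) => cp p i
  left_inv g := by cases g <;> rfl
  right_inv s := by rcases s with q | q | ⟨p, i⟩ | ⟨p, i⟩ <;> rfl

/-- The gates form a finite type. [folklore] -/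
instance instFintype : Fintype (ACGate t L) := Fintype.ofEquiv _ (equivSum t L).symm

/-- The number of gates. [folklore] -/
theorem card_eq : Fintype.card (ACGate t L) =
    (leafSet t).card + (nodeSet t).card + (pairSet t).card * L + (pairSet t).card * L := by
  rw [Fintype.card_congr (equivSum t L)]
  simp only [Fintype.card_sum, Fintype.card_coe, Fintype.card_prod, Fintype.card_fin]
  ring

end ACGate

open ACGate

/-- The gate of a reachable class: its input gate if it is a leaf, its node gate otherwise.
[folklore] -/
def gateOf (k : ACClass 𝔽 X) (hk : k ∈ reach t) : ACGate t L :=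
  if h : k.label.IsInput then leaf ⟨k, mem_leafSet.2 ⟨hk, h⟩⟩ else node ⟨k, mem_nodeSet.2 ⟨hk, h⟩⟩

/-- The label of a gate: the class label for leaves, nodes and chain elements (which carry the
operation of the PARENT of their pair), `+` for the copies. [folklore] -/
def gLabel : ACGate t L → CircuitLabel 𝔽 X
  | leaf q => q.1.label
  | node q => q.1.label
  | pw p _ => p.1.1.label
  | cp _ _ => .add

/-- The wiring relation: `IsChild h g` means `h` is wired into `g`. [folklore] -/
def IsChild (h : ACGate t L) : ACGate t L → Prop
  | leaf _ => False
  | node q => ∃ (p : {p // p ∈ pairSet t}) (i : Fin L),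
      h = pw p i ∧ p.1.1 = q.1 ∧ i.1 ∈ (q.1.kids.count p.1.2).bitIndices
  | pw p i => (i.1 = 0 ∧ h = gateOf t L p.1.2 (snd_mem_reach p)) ∨
      ∃ j : Fin L, j.1 + 1 = i.1 ∧ (h = pw p j ∨ h = cp p j)
  | cp p i => h = pw p i

/-- A rank decreasing along the wires. [folklore] -/
def rk : ACGate t L → ℕ
  | leaf _ => 0
  | node q => (2 * L + 2) * q.1.size
  | pw p i => (2 * L + 2) * p.1.2.size + 2 * i.1 + 1
  | cp p i => (2 * L + 2) * p.1.2.size + 2 * i.1 + 2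

variable {t L}

/-- The rank of the gate of a class. [folklore] -/
theorem rk_gateOf_le (k : ACClass 𝔽 X) (hk : k ∈ reach t) : rk t L (gateOf t L k hk) ≤ (2 * L + 2) * k.size := by
  unfold gateOf; split <;> simp [rk]

/-- Wires decrease the rank. [folklore] -/
theorem rk_lt_of_isChild {h g : ACGate t L} (hc : IsChild t L h g) : rk t L h < rk t L g := by
  cases g with
  | leaf q => exact hc.elim
  | node q =>
    obtain ⟨p, i, rfl, hpq, -⟩ := hc
    have hs : p.1.2.size + 1 ≤ q.1.size := hpq ▸ size_snd_lt p
    have hi := i.2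
    simp only [rk]
    calc (2 * L + 2) * p.1.2.size + 2 * i.1 + 1 < (2 * L + 2) * p.1.2.size + (2 * L + 2) := by omega
      _ = (2 * L + 2) * (p.1.2.size + 1) := by ring
      _ ≤ (2 * L + 2) * q.1.size := Nat.mul_le_mul_left _ hs
  | pw p i =>
    rcases hc with ⟨hi, rfl⟩ | ⟨j, hj, rfl | rfl⟩
    · exact lt_of_le_of_lt (rk_gateOf_le _ _) (by simp [rk])
    · simp [rk]; omega
    · simp [rk]; omega
  | cp p i =>
    subst hc
    simp [rk]

/-- The gate of a class, leaf case. [folklore] -/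
theorem gateOf_of_isInput {k : ACClass 𝔽 X} (hk : k ∈ reach t) (h : k.label.IsInput) :
    gateOf t L k hk = leaf ⟨k, mem_leafSet.2 ⟨hk, h⟩⟩ := by
  simp [gateOf, h]

/-- The gate of a class, internal case. [folklore] -/
theorem gateOf_of_not_isInput {k : ACClass 𝔽 X} (hk : k ∈ reach t) (h : ¬ k.label.IsInput) :
    gateOf t L k hk = node ⟨k, mem_nodeSet.2 ⟨hk, h⟩⟩ := by
  simp [gateOf, h]

/-- The label of the gate of a class is the label of the class. [folklore] -/
theorem gLabel_gateOf (k : ACClass 𝔽 X) (hk : k ∈ reach t) : gLabel t L (gateOf t L k hk) = k.label := by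
  unfold gateOf; split <;> rfl

/-- Labels of leaves are input labels; the others are not. [folklore] -/
theorem isInput_gLabel_iff (g : ACGate t L) : (gLabel t L g).IsInput ↔ ∃ q, g = leaf q := by
  cases g with
  | leaf q => simpa [gLabel] using (mem_leafSet.1 q.2).2
  | node q => simpa [gLabel] using (mem_nodeSet.1 q.2).2
  | pw p i => simpa [gLabel] using not_isInput_fst p
  | cp p i => simp [gLabel, CircuitLabel.IsInput]

/-- Binary digits of multiplicities are below `L` when multiplicities are `< 2^L`. [folklore] -/
theorem lt_of_mem_bitIndices_count (hL : ∀ q ∈ reach t, Multiset.card q.kids < 2 ^ L)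
    {q k : ACClass 𝔽 X} (hq : q ∈ reach t) {i : ℕ} (hi : i ∈ (q.kids.count k).bitIndices) : i < L := by
  have h1 : 2 ^ i ≤ q.kids.count k := Nat.two_pow_le_of_mem_bitIndices hi
  have h2 : q.kids.count k ≤ Multiset.card q.kids := Multiset.count_le_card _ _
  have h3 := hL q hq
  by_contra hc
  have : 2 ^ L ≤ 2 ^ i := Nat.pow_le_pow_right (by norm_num) (by omega)
  omega

/-- An internal class has a child with a nonzero multiplicity digit below `L`. [folklore] -/
theorem exists_isChild_node (hL : ∀ q ∈ reach t, Multiset.card q.kids < 2 ^ L)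
    (q : {q // q ∈ nodeSet t}) : ∃ h, IsChild t L h (node q) := by
  obtain ⟨hq, hn⟩ := mem_nodeSet.1 q.2
  have hcard : 2 ≤ Multiset.card q.1.kids := two_le_card_kids hn
  obtain ⟨k, hk⟩ : ∃ k, k ∈ q.1.kids := Multiset.card_pos_iff_exists_mem.1 (by omega)
  set m := q.1.kids.count k with hm
  have hm1 : 1 ≤ m := Multiset.one_le_count_iff_mem.2 hk
  have hne : m.bitIndices ≠ [] := fun hnil => by
    have := Nat.sum_map_two_pow_bitIndices m
    rw [hnil] at this
    simp at this
    omega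
  obtain ⟨i, hi⟩ := List.exists_mem_of_ne_nil _ hne
  have hiL : i < L := lt_of_mem_bitIndices_count hL hq hi
  exact ⟨pw (mkPair q.1 k hq hn hk) ⟨i, hiL⟩, mkPair q.1 k hq hn hk, ⟨i, hiL⟩, rfl, rfl, hi⟩

variable (t L)

/-- **The AC-canonical circuit** of the class `t` with chain length `L` (assuming all
multiplicities of children of reachable classes are `< 2^L`): a Dawar–Wilsenach labelled
arithmetic circuit on the gates `ACGate t L`, single output the gate of `t`. [folklore] -/
def acCircuit (hL : ∀ q ∈ reach t, Multiset.card q.kids < 2 ^ L) :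
    LabelledArithCircuit 𝔽 X Unit (ACGate t L) where
  children g := Finset.univ.filter fun h => IsChild t L h g
  label := gLabel t L
  output _ := gateOf t L t (self_mem_reach t)
  wf := by
    refine Subrelation.wf (r := InvImage (· < ·) (rk t L)) ?_ (InvImage.wf _ Nat.lt_wfRel.wf)
    intro h g hm
    exact rk_lt_of_isChild (by simpa using hm)
  isInput_iff g := by
    rw [isInput_gLabel_iff, Finset.filter_eq_empty_iff]
    constructor
    · rintro ⟨q, rfl⟩ h _; exact id
    · intro hno
      cases g with
      | leaf q => exact ⟨q, rfl⟩
      | node q =>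
        obtain ⟨h, hh⟩ := exists_isChild_node hL q
        exact absurd hh (hno (Finset.mem_univ h))
      | pw p i =>
        exfalso
        rcases Nat.eq_zero_or_pos i.1 with hi | hi
        · exact hno (Finset.mem_univ (gateOf t L p.1.2 (snd_mem_reach p))) (Or.inl ⟨hi, rfl⟩)
        · exact hno (Finset.mem_univ (pw p ⟨i.1 - 1, by omega⟩))
            (Or.inr ⟨⟨i.1 - 1, by omega⟩, by simp; omega, Or.inl rfl⟩)
      | cp p i => exact absurd rfl (hno (Finset.mem_univ (pw p i)))
  eq_of_label_eq g g' hin hl := by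
    obtain ⟨q, rfl⟩ := (isInput_gLabel_iff g).1 hin
    obtain ⟨q', rfl⟩ := (isInput_gLabel_iff g').1 (hl ▸ hin)
    simp only [gLabel] at hl
    have := ACClass.eq_of_label_eq_of_isInput (mem_leafSet.1 q.2).2 hl
    rw [Subtype.ext this]
  output_injective := fun _ _ _ => Subsingleton.elim _ _

variable {t L}

/-- The children of a gate of the AC-canonical circuit. [folklore] -/
theorem mem_children_acCircuit (hL : ∀ q ∈ reach t, Multiset.card q.kids < 2 ^ L) (h g : ACGate t L) :
    h ∈ (acCircuit t L hL).children g ↔ IsChild t L h g := by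
  simp [acCircuit]

/-! ### Symmetry -/

section Symmetry

variable {Γ : Type*} [Group Γ] [MulAction Γ X] {γ : Γ}

/-- A group element fixing `t` moves reachable leaf classes to reachable leaf classes. [folklore] -/
theorem smul_mem_leafSet (hγ : γ • t = t) {q : ACClass 𝔽 X} (hq : q ∈ leafSet t) : γ • q ∈ leafSet t := by
  rw [mem_leafSet] at hq ⊢
  exact ⟨smul_mem_reach hγ hq.1, by rw [label_smul, CircuitLabel.isInput_smul]; exact hq.2⟩

/-- … internal classes to internal classes. [folklore] -/
theorem smul_mem_nodeSet (hγ : γ • t = t) {q : ACClass 𝔽 X} (hq : q ∈ nodeSet t) : γ • q ∈ nodeSet t := by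
  rw [mem_nodeSet] at hq ⊢
  exact ⟨smul_mem_reach hγ hq.1, by rw [label_smul, CircuitLabel.isInput_smul]; exact hq.2⟩

/-- … and pairs to pairs. [folklore] -/
theorem smul_mem_pairSet (hγ : γ • t = t) {p : ACClass 𝔽 X × ACClass 𝔽 X} (hp : p ∈ pairSet t) :
    (γ • p.1, γ • p.2) ∈ pairSet t := by
  rw [mem_pairSet] at hp ⊢
  refine ⟨⟨smul_mem_reach hγ hp.1.1, smul_mem_reach hγ hp.1.2⟩, ?_, ?_⟩
  · rw [label_smul, CircuitLabel.isInput_smul]; exact hp.2.1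
  · rw [mem_kids_smul_iff, inv_smul_smul]; exact hp.2.2

/-- The action of a group element fixing `t` on the gates. [folklore] -/
def gperm (γ : Γ) (hγ : γ • t = t) : ACGate t L → ACGate t L
  | leaf q => leaf ⟨γ • q.1, smul_mem_leafSet hγ q.2⟩
  | node q => node ⟨γ • q.1, smul_mem_nodeSet hγ q.2⟩
  | pw p i => pw ⟨(γ • p.1.1, γ • p.1.2), smul_mem_pairSet hγ p.2⟩ i
  | cp p i => cp ⟨(γ • p.1.1, γ • p.1.2), smul_mem_pairSet hγ p.2⟩ i

/-- The inverse also fixes `t`. [folklore] -/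
theorem inv_smul_eq (hγ : γ • t = t) : γ⁻¹ • t = t := by
  conv_lhs => rw [← hγ]
  rw [inv_smul_smul]

/-- `gperm γ⁻¹ ∘ gperm γ = id`. [folklore] -/
theorem gperm_inv_gperm (hγ : γ • t = t) (g : ACGate t L) :
    gperm γ⁻¹ (inv_smul_eq hγ) (gperm γ hγ g) = g := by
  cases g <;> simp [gperm]

/-- `gperm γ ∘ gperm γ⁻¹ = id`. [folklore] -/
theorem gperm_gperm_inv (hγ : γ • t = t) (g : ACGate t L) :
    gperm γ hγ (gperm γ⁻¹ (inv_smul_eq hγ) g) = g := by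
  cases g <;> simp [gperm]

/-- The action of a group element fixing `t` on the gates, as a permutation. [folklore] -/
def gpermEquiv (γ : Γ) (hγ : γ • t = t) : Equiv.Perm (ACGate t L) where
  toFun := gperm γ hγ
  invFun := gperm γ⁻¹ (inv_smul_eq hγ)
  left_inv := gperm_inv_gperm hγ
  right_inv := gperm_gperm_inv hγ

/-- `gperm` moves the gate of a class to the gate of the moved class. [folklore] -/
theorem gperm_gateOf (hγ : γ • t = t) (k : ACClass 𝔽 X) (hk : k ∈ reach t) :
    gperm (L := L) γ hγ (gateOf t L k hk) = gateOf t L (γ • k) (smul_mem_reach hγ hk) := by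
  by_cases h : k.label.IsInput
  · have h' : (γ • k).label.IsInput := by rw [label_smul, CircuitLabel.isInput_smul]; exact h
    rw [gateOf_of_isInput hk h, gateOf_of_isInput _ h']; rfl
  · have h' : ¬ (γ • k).label.IsInput := by rw [label_smul, CircuitLabel.isInput_smul]; exact h
    rw [gateOf_of_not_isInput hk h, gateOf_of_not_isInput _ h']; rfl

/-- `gateOf` does not depend on the membership proof and respects equality of classes.
[folklore] -/
theorem gateOf_congr {k k' : ACClass 𝔽 X} (hk : k ∈ reach t) (hk' : k' ∈ reach t) (e : k = k') :
    gateOf t L k hk = gateOf t L k' hk' := by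
  subst e; rfl

/-- `gperm` preserves the wiring relation. [folklore] -/
theorem isChild_gperm (hγ : γ • t = t) {h g : ACGate t L} (hc : IsChild t L h g) :
    IsChild t L (gperm γ hγ h) (gperm γ hγ g) := by
  cases g with
  | leaf q => exact hc.elim
  | node q =>
    obtain ⟨p, i, rfl, hpq, hi⟩ := hc
    refine ⟨⟨(γ • p.1.1, γ • p.1.2), smul_mem_pairSet hγ p.2⟩, i, rfl, by simp [hpq], ?_⟩
    simpa [hpq, count_kids_smul] using hi
  | pw p i =>
    rcases hc with ⟨hi, rfl⟩ | ⟨j, hj, rfl | rfl⟩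
    · left
      exact ⟨hi, by rw [gperm_gateOf]⟩
    · exact Or.inr ⟨j, hj, Or.inl rfl⟩
    · exact Or.inr ⟨j, hj, Or.inr rfl⟩
  | cp p i => subst hc; rfl

/-- **Every group element fixing `t` extends to an automorphism of the AC-canonical circuit**
(Dawar–Wilsenach Def. 3.6). [folklore] -/
theorem isAutomorphismExtending_gperm (hL : ∀ q ∈ reach t, Multiset.card q.kids < 2 ^ L)
    (γ : Γ) (hγ : γ • t = t) :
    (acCircuit t L hL).IsAutomorphismExtending γ (gpermEquiv (L := L) γ hγ) where
  children_apply g := by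
    ext h
    simp only [Finset.mem_map_equiv, mem_children_acCircuit]
    constructor
    · intro hc
      have := isChild_gperm (inv_smul_eq hγ) hc
      simpa [gpermEquiv, gperm_inv_gperm] using this
    · intro hc
      have := isChild_gperm hγ hc
      simpa [gpermEquiv, gperm_gperm_inv] using this
  label_apply g := by
    cases g with
    | leaf q => exact label_smul γ q.1
    | node q => exact label_smul γ q.1
    | pw p i => exact label_smul γ p.1.1
    | cp p i => rfl
  output_smul y := by
    change gateOf t L t (self_mem_reach t) = gperm γ hγ (gateOf t L t (self_mem_reach t))
    rw [gperm_gateOf]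
    exact gateOf_congr _ _ hγ.symm

/-- **The AC-canonical circuit is `Γ`-symmetric** (Dawar–Wilsenach Def. 3.7) as soon as `Γ`
fixes the class `t`. [folklore] -/
theorem isSymmetric_acCircuit (hL : ∀ q ∈ reach t, Multiset.card q.kids < 2 ^ L)
    (ht : ∀ γ : Γ, γ • t = t) : (acCircuit t L hL).IsSymmetric Γ :=
  fun γ => ⟨gpermEquiv γ (ht γ), isAutomorphismExtending_gperm hL γ (ht γ)⟩

end Symmetry

end Gates

end ACStability

open Literature.Computability.AlgebraicComplexity in
/-- **Symmetry of the AC-canonical circuit of an AC-provably invariant circuit** (registered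
helper of stub S3 `stub_stabilityAtACBudget`, crux `RestorationQP`): if all invariance identities
`C ∘ σ = C` have `P_c(ℂ)` proofs without A6–A10, the AC-canonical circuit of `topClass C` (chain
length `|C| + 1`) is `S_n`-symmetric in Dawar–Wilsenach's sense. [folklore] -/
theorem stabilityAtACBudget_aux_symmetric : ∀ (n : ℕ) (C : PICircuit ℂ (Fin n × Fin n)), (∀ σ : Equiv.Perm (Fin n), HasPCProof (C.rename fun x : Fin n × Fin n => σ • x) C (fun s => if s = PIAxiom.A6 ∨ s = PIAxiom.A7 ∨ s = PIAxiom.A8 ∨ s = PIAxiom.A9 ∨ s = PIAxiom.A10 then 0 else ⊤)) → (ACStability.acCircuit (ACStability.topClass C) (C.size + 1) (fun _ hq => ACStability.card_kids_lt_of_mem_reach hq)).IsSymmetric (Equiv.Perm (Fin n)) := by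
  intro n C h
  exact ACStability.isSymmetric_acCircuit _ (stabilityAtACBudget_aux_topClass n C h)

end Summit.ValiantsHypothesis.ValiantsHypothesis.Theorems

end
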